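import Literature.Computability.MetaComplexity.DistProblems
import Literature.Computability.MetaComplexity.UniversalHeuristicSchemes
import HarnessLib

/-!
# Complexity meta: one-sided-error heuristics `Avg¹_δ P` and the tally ensemble (Hirahara 2021, Def. 3.3)

Topic `Literature/Computability/MetaComplexity`, companion to `DistProblems.lean` (`Ensemble`, `DistProblem`,
`distClass`, `AvgP`, `Heur_δ P`) and `UniversalHeuristicSchemes.lean` (Hirahara's universal heuristic
schemes, Def. 6.2, and the named fact `Hirahara2021_hasUHS_of_mem_UP` = Lemma 2.2 (1) of
S. Hirahara, *Average-case hardness of NP from exponential worst-case hardness assumptions*, STOC 2021,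
full version ECCC TR21-058, whose numbering is cited throughout).

The paper proves Lemma 2.2 (1) (`DistNP ⊆ AvgP ⟹` every `L ∈ UP` admits a universal heuristic
scheme) through the *weaker* average-case hypothesis of its "actual results" (p. 8–9, §11):

  `coNP × {U, T} ⊆ Avg¹_{1-n^{-c}} P` for some constant `c`,

where `U` is the uniform ensemble, `T` the tally ensemble, and `Avg¹_δ P` the class of distributional
problems with a polynomial-time *one-sided-error* heuristic algorithm of failure probability `δ`
(Def. 3.3: never accepts a No instance of the support; correct with probability `≥ 1 - δ(n)`). By
Cor. 8.12, under this hypothesis every language of `NP_sv ⊇ UP` (Fact 8.4) admits a universal heuristic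
scheme, and p. 51 records "Since `UP ⊆ NP_sv`, Item 1 of Theorem 1.6 is a special case of
Theorem 11.1". This file vendors that layer:

* `tallyEnsemble` — `T = (Tₙ)ₙ`, `Tₙ` the point mass on `1ⁿ` (p. 8–9), with its support, length and
  probability API;
* `Avg1DeltaP δ` — `Avg¹_δ P` (Def. 3.3), in the conventions of `DistProblems.lean` (algorithm
  `A(x; 1ⁿ) ∈ {0,1}` polynomial-time on `paramEnc (x, n) = ⟨x, 1ⁿ⟩`, conditions on `supp Dₙ`,
  `δ : ℕ → ℝ` unconstrained), with `Avg1DeltaP_mono`, `Avg1DeltaP_subset_HeurDeltaP` (a one-sided-error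
  heuristic of failure probability `δ` errs with probability `≤ δ`) and the non-vacuity theorem
  `distClass_P_subset_Avg1DeltaP` (`(P, 𝒟) ⊆ Avg¹_δ P` whenever `δ ≥ 0`);
* (no named fact.) Cor. 8.12 specialised along Fact 8.4 to `UP` — *if
  `coNP × {U, T} ⊆ Avg¹_{1-n^{-c}} P` for some constant `c`, then every `L ∈ UP` admits a universal
  heuristic scheme* — is **not** a named fact of its own: it is the decision form of the paper's
  Thm. 8.9, vendored (for `UP`-type verifiers) as the named fact `Hirahara2021_UP_searchUHS_of_Avg1P`
  of `SearchHeuristicSchemes.lean`, and is PROVED from it there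
  (`Hirahara2021_UP_hasUHS_of_Avg1P_of_search`, the printed one-line proof "Since a decision problem
  reduces to its search version"); one published result, one debt entry (D-0026).

The implication `DistNP ⊆ AvgP ⟹ coNP × {U, T} ⊆ Avg¹_{1-n^{-c}} P` (p. 9: "it is easy to see that
`Avg_P P ⊆ AvgP ⊆ Avg¹_{1-n^{-c}} P`", plus closure of `AvgP` under complementing the language and
`U, T ∈ PSamp`) and the assemblies "Cor. 8.12 for `UP` ⟹ `Hirahara2021_hasUHS_of_mem_UP`" and
"`Hirahara2021_UP_searchUHS_of_Avg1P` ⟹ `Hirahara2021_hasUHS_of_mem_UP`" (Lemma 2.2 (1)) are *proved*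
in the sibling `OneSidedHeuristicsProofs.lean`.

## Design choices

* `Avg¹_δ P` follows `HeurDeltaP` of `DistProblems.lean` to the letter (same input encoding `paramEnc`,
  same `δ : ℕ → ℝ`, success measured by `Ensemble.prob`), adding Def. 3.3 (1) on the support of `Dₙ`
  (as all support-relative conditions of that file) and replacing the error bound by the printed
  success bound `Pr_{x ∼ Dₙ}[A(x; 1ⁿ) = L(x)] ≥ 1 - δ(n)`.
* Hirahara's failure probability `δ(n) = 1 - n^{-c}` is rendered `fun n => 1 - 1 / (n : ℝ) ^ c` with
  `c : ℕ`; the printed condition is then "success probability `≥ n^{-c}`" (p. 9). At `n = 0` Lean's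
  `1 / 0 = 0` makes the condition void (the paper's `0^{-c}` is undefined; immaterial), and at `n = 1`
  it demands success probability `1`, literally as printed. The constant is quantified `∃ c : ℕ`
  (for `c = 0` the hypothesis only gets stronger, and `Avg1DeltaP` is monotone in `δ`, so this is the
  printed "for some constant `c`").
* `NP_sv` (Def. 8.2: `NP` with an `NP`-type verifier whose number of certificates is approximable
  within a factor `t(|x|)` by an `AM` protocol) and `pr-AMTIME(t)` are **not** vendored: the only
  consumer (Thm. 1.6 (1)) needs the `UP` case, for which the certificate count is `≤ 1` and the
  promise problem of Def. 8.2 is trivial (proof of Fact 8.4); see `SearchHeuristicSchemes.lean`.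
* Hirahara's hypothesis "`coNP × {U, T} ⊆ Avg¹_{1-n^{-c}} P` for some constant `c`" is written, by
  every consumer, as `∃ c : ℕ, distClass coNP {uniformEnsemble, tallyEnsemble} ⊆
  Avg1DeltaP fun n => 1 - 1 / (n : ℝ) ^ c`.

Mathlib has no average-case classes (searched `OneSided`, `Avg1`, `tally`: only
`Literature.Barriers.PneNP.RelativizationSparse.IsTally` for *languages*); `Ensemble`, `uniformEnsemble`,
`distClass`, `P` are reused. (The import of `UniversalHeuristicSchemes.lean` is kept for the importers of
this file, which combine `Avg¹_δ P` with Def. 6.2.)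

## References

* S. Hirahara, *Average-case hardness of NP from exponential worst-case hardness assumptions*, STOC 2021,
  292–302; full version ECCC TR21-058 (2021): p. 8–9 (`U`, `T`, `Avg¹_{1-n^{-c}} P`), Def. 3.3, Lemma 3.6,
  Fact 8.4, Thm. 8.9, Cor. 8.12, Thm. 11.1 and the remark following it (p. 51).
* A. Bogdanov, L. Trevisan, *Average-Case Complexity*, Found. Trends TCS 2 (2006), Ch. 2 (heuristic
  classes; the conventions of `DistProblems.lean`).
-/

namespace Literature.Computability.MetaComplexity

open _root_.Computability Complexity Complexity.Classes Complexity.Nondeterministic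
open scoped ENNReal

/-! ### The tally ensemble -/

/-- The **tally ensemble** `T = (Tₙ)ₙ`: `Tₙ` is the distribution whose support is `{1ⁿ}` (the point
mass `PMF.pure` on Mathlib's unary numeral `unaryEncodeNat n = 1ⁿ`).
[Hirahara 2021 (ECCC TR21-058), p. 8–9 ("`T = {Tₙ}` … the family of the distributions `Tₙ` whose
support is `{1ⁿ}`")] [cite: Hirahara2021, §1.3 (p. 8–9)] -/
noncomputable def tallyEnsemble : Ensemble := fun n => PMF.pure (unaryEncodeNat n)

/-- The support of `Tₙ` is `{1ⁿ}`. [Hirahara 2021 (ECCC TR21-058), p. 9; Mathlib `PMF.support_pure`]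
[cite: Hirahara2021, §1.3 (p. 9)] -/
@[simp] theorem support_tallyEnsemble (n : ℕ) : (tallyEnsemble n).support = {unaryEncodeNat n} :=
  PMF.support_pure _

/-- `x ∈ supp Tₙ ↔ x = 1ⁿ`. [Hirahara 2021 (ECCC TR21-058), p. 9] [cite: Hirahara2021, §1.3 (p. 9)] -/
theorem mem_support_tallyEnsemble_iff (n : ℕ) (x : List Bool) :
    x ∈ (tallyEnsemble n).support ↔ x = unaryEncodeNat n := by
  rw [support_tallyEnsemble, Set.mem_singleton_iff]

/-- The tally ensemble has linearly bounded support lengths (`|1ⁿ| = n`).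
[Bogdanov–Trevisan 2006, §2.1 (`|x| ≤ poly(n)` on the support)] [cite: BogdanovTrevisan2006, §2.1] -/
theorem hasPolyLength_tallyEnsemble : tallyEnsemble.HasPolyLength := by
  refine ⟨Polynomial.X, fun n x hx => ?_⟩
  rw [(mem_support_tallyEnsemble_iff n x).1 hx, Polynomial.eval_X]
  exact (unary_decode_encode_nat n).le

/-- Probabilities under the tally ensemble: `Pr_{x ∼ Tₙ}[x ∈ E] = 1` if `1ⁿ ∈ E`.
[Hirahara 2021 (ECCC TR21-058), p. 9; Mathlib `PMF.toOuterMeasure_pure_apply`] [cite: Hirahara2021, §1.3 (p. 9)] -/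
theorem prob_tallyEnsemble_of_mem {n : ℕ} {E : Set (List Bool)} (h : unaryEncodeNat n ∈ E) :
    tallyEnsemble.prob n E = 1 := by
  rw [Ensemble.prob, tallyEnsemble, PMF.toOuterMeasure_pure_apply, if_pos h, ENNReal.toReal_one]

/-- Probabilities under the tally ensemble: `Pr_{x ∼ Tₙ}[x ∈ E] = 0` if `1ⁿ ∉ E`.
[Hirahara 2021 (ECCC TR21-058), p. 9; Mathlib `PMF.toOuterMeasure_pure_apply`] [cite: Hirahara2021, §1.3 (p. 9)] -/
theorem prob_tallyEnsemble_of_not_mem {n : ℕ} {E : Set (List Bool)} (h : unaryEncodeNat n ∉ E) :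
    tallyEnsemble.prob n E = 0 := by
  rw [Ensemble.prob, tallyEnsemble, PMF.toOuterMeasure_pure_apply, if_neg h, ENNReal.toReal_zero]

/-! ### One-sided-error heuristics (Def. 3.3) -/

/-- `Avg1DeltaP δ` (`Avg¹_δ P`): distributional problems `(L, D)` admitting a polynomial-time
**one-sided-error heuristic algorithm with failure probability `δ`** — a deterministic algorithm
`A(x; 1ⁿ) ∈ {0,1}`, polynomial-time in `|⟨x, 1ⁿ⟩|` (`paramEnc`), such that for every `n`:
(1) `L(x) = 0 ⟹ A(x; 1ⁿ) = 0` for every `x ∈ supp Dₙ` (no false positives on the support), and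
(2) `Pr_{x ∼ Dₙ}[A(x; 1ⁿ) = L(x)] ≥ 1 - δ(n)`.
As for `HeurDeltaP`, `δ : ℕ → ℝ` is unconstrained (the paper takes `δ : ℕ → (0,1)`); Hirahara's
`Avg¹_{1-n^{-c}} P` is `Avg1DeltaP fun n => 1 - 1 / (n : ℝ) ^ c` (success probability `≥ n^{-c}`).
[Hirahara 2021 (ECCC TR21-058), Def. 3.3 and p. 9] [cite: Hirahara2021, Def. 3.3] -/
noncomputable def Avg1DeltaP (δ : ℕ → ℝ) : Set DistProblem :=
  {Q | ∃ A : List Bool → ℕ → Bool,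
    PolyTimeComputable paramEnc encodeBool (Function.uncurry A) ∧
      (∀ n, ∀ x ∈ (Q.dist n).support, x ∉ Q.lang → A x n = false) ∧
      ∀ n, 1 - δ n ≤ Q.dist.prob n {x | A x n = Q.lang.boolIndicator x}}

/-- `Avg¹_δ P` is monotone in the failure probability: `δ ≤ δ' ⟹ Avg¹_δ P ⊆ Avg¹_{δ'} P`.
[Hirahara 2021 (ECCC TR21-058), Def. 3.3] [cite: Hirahara2021, Def. 3.3] -/
theorem Avg1DeltaP_mono {δ δ' : ℕ → ℝ} (h : ∀ n, δ n ≤ δ' n) : Avg1DeltaP δ ⊆ Avg1DeltaP δ' := by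
  rintro Q ⟨A, hA, h1, h2⟩
  exact ⟨A, hA, h1, fun n => (sub_le_sub_left (h n) 1).trans (h2 n)⟩

/-- Complementary events have complementary probabilities under `Dₙ`:
`Pr_{x ∼ Dₙ}[E] + Pr_{x ∼ Dₙ}[Eᶜ] = 1` (the outer measure of a `PMF` is the sum of the masses,
`PMF.toOuterMeasure_apply`, and `1_E · p + 1_{Eᶜ} · p = p` sums to `1`). A deliberate dot-notation
extension of `Ensemble` (`DistProblems.lean`). [Mathlib `PMF.toOuterMeasure_apply`, `PMF.tsum_coe`]
[folklore] -/
theorem Ensemble.prob_add_prob_compl (D : Ensemble) (n : ℕ) (E : Set (List Bool)) :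
    D.prob n E + D.prob n Eᶜ = 1 := by
  have hsum : (D n).toOuterMeasure E + (D n).toOuterMeasure Eᶜ = 1 := by
    rw [PMF.toOuterMeasure_apply, PMF.toOuterMeasure_apply, ← ENNReal.tsum_add]
    simp_rw [Set.indicator_self_add_compl_apply]
    exact (D n).tsum_coe
  have hE : (D n).toOuterMeasure E ≠ ⊤ :=
    ne_top_of_le_ne_top ENNReal.one_ne_top (hsum ▸ le_self_add)
  have hEc : (D n).toOuterMeasure Eᶜ ≠ ⊤ :=
    ne_top_of_le_ne_top ENNReal.one_ne_top (hsum ▸ le_add_self)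
  unfold Ensemble.prob
  rw [← ENNReal.toReal_add hE hEc, hsum, ENNReal.toReal_one]

/-- **A one-sided-error heuristic algorithm is a heuristic algorithm with the same failure
probability**: `Avg¹_δ P ⊆ Heur_δ P` (the error event is the complement of the success event, so
`Pr[A ≠ L] = 1 - Pr[A = L] ≤ δ(n)`). [Hirahara 2021 (ECCC TR21-058), Def. 3.3; Bogdanov–Trevisan
2006, Def. 2.10] [cite: Hirahara2021, Def. 3.3] -/
theorem Avg1DeltaP_subset_HeurDeltaP (δ : ℕ → ℝ) : Avg1DeltaP δ ⊆ HeurDeltaP δ := by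
  rintro Q ⟨A, hA, -, h2⟩
  refine ⟨A, hA, fun n => ?_⟩
  have hc : {x | A x n ≠ Q.lang.boolIndicator x} = {x | A x n = Q.lang.boolIndicator x}ᶜ := by
    ext x; simp
  have hadd := Q.dist.prob_add_prob_compl n {x | A x n = Q.lang.boolIndicator x}
  rw [hc]
  linarith [h2 n]

/-- For `L ∈ P`, the parameter-ignoring decider `⟨x, 1ⁿ⟩ ↦ L(x)` is polynomial-time on `paramEnc`:
decide `L` (`mem_P_iff_holds`) after the first pair projection (`boolUnpairFst_mem_FP`), composed by
`PolyTimeComputable.comp_holds`. [Arora–Barak 2009, §1.3 (composition); Bogdanov–Trevisan 2006, §2.1]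
[folklore] -/
theorem polyTimeComputable_paramEnc_boolIndicator {L : Language Bool} (hL : L ∈ P) :
    PolyTimeComputable paramEnc encodeBool
      (Function.uncurry fun (x : List Bool) (_ : ℕ) => L.boolIndicator x) := by
  have hdec : PolyTimeComputable id encodeBool L.boolIndicator :=
    polyTimeDecidable_iff.1 (mem_P_iff_holds.1 hL)
  have hfst : PolyTimeComputable (id : List Bool → List Bool) id fun z => (boolUnpair z).1 :=
    boolUnpairFst_mem_FP
  obtain ⟨p, M, hM⟩ := PolyTimeComputable.comp_holds hdec hfst
  refine ⟨p, M, fun q => ?_⟩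
  have hq : (boolUnpair (paramEnc q)).1 = q.1 := by simp [paramEnc]
  have h := hM (paramEnc q)
  simp only [id, Function.comp, hq] at h
  exact h

/-- **Non-vacuity of Def. 3.3.** Worst-case polynomial time is one-sided-error heuristic polynomial
time for every ensemble and every nonnegative failure probability: `(P, 𝒟) ⊆ Avg¹_δ P` for `δ ≥ 0`
(the decider of `L` ignores `1ⁿ`, never errs, and succeeds with probability `1 ≥ 1 - δ(n)`).
[Hirahara 2021 (ECCC TR21-058), Def. 3.3; Bogdanov–Trevisan 2006, §2.1 (worst-case easy problems are
average-case easy)] [cite: Hirahara2021, Def. 3.3] -/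
theorem distClass_P_subset_Avg1DeltaP {δ : ℕ → ℝ} (hδ : ∀ n, 0 ≤ δ n) :
    distClass P Set.univ ⊆ Avg1DeltaP δ := by
  rintro Q ⟨hL, -⟩
  refine ⟨fun x _ => Q.lang.boolIndicator x, polyTimeComputable_paramEnc_boolIndicator hL,
    fun n x _ hx => ?_, fun n => ?_⟩
  · exact (Set.notMem_iff_boolIndicator _ _).1 hx
  · have h1 : Q.dist.prob n {x | Q.lang.boolIndicator x = Q.lang.boolIndicator x} = 1 := by
      simp only [Set.setOf_true]
      rw [Ensemble.prob, (PMF.toOuterMeasure_apply_eq_one_iff _ _).2 (Set.subset_univ _),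
        ENNReal.toReal_one]
    rw [h1]
    linarith [hδ n]

end Literature.Computability.MetaComplexity
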